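import Summits.SmoothPoincare4.SmoothPoincare4.Theorems.CylinderEntropyCylinderRungTwoHamiltonMonotonicityTransport
import Summits.SmoothPoincare4.SmoothPoincare4.Theorems.CylinderEntropyCylinderRungTwoHamiltonMonotonicityDivergence
import Summits.SmoothPoincare4.SmoothPoincare4.Theorems.CylinderEntropyCylinderRungTwoHamiltonMonotonicityKernelFlow
import Summits.SmoothPoincare4.SmoothPoincare4.Theorems.CylinderEntropyCylinderRungTwoHamiltonMonotonicityDensity
import HarnessLib

/-!
# Hamilton's monotonicity along a smooth cylinder flow, part 6: the monotonicity FORMULA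

Part 6 of the proof of the registered stub `stub_hamiltonMonotonicity` of line `killing-flux` of the
crux `CylinderEntropy.CylinderRungTwo` (stmt-SmoothPoincare4-7631): Hamilton's monotonicity formula
(Comm. Anal. Geom. 1 (1993) 127–137, Thm. 4.1, hypersurface case) for the typed slice-normalised
density `Z(t) = F̂_{p, t₀ - t}(F_t(M))` of a smooth mean curvature flow `IsCylinderMCF M F ν T` of
closed embedded cross-sections of `N = S⁴ × ℝ ⊂ ℝ⁶`:

* `IsCylinderMCF.hasDerivAt_cylDensity` — for `T < t < t₀`,
  `Z'(t) = -D - (μH⁴ S⁴)⁻¹ ∫_{F_t(M)} Q_{p,t₀-t}(z; ν) dμH⁴`, `D = c ∫ k (H + Dk(ν)/k)² ≥ 0`, `Q` the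
  Harnack quadratic form of the typed kernel along `N` on the unit normal. Assembly: the density is
  `c ∫_M k_{p,t₀-s}(F_s w) dμ_s` (part 5), its derivative is `c ∫_M (-∂_τk - H Dk(ν) - H²k) dμ_t`
  (transport formula, part 1, with the kernel data of part 4), `0 = c ∫_M Δ_Σ(k|_Σ) dμ_t` (Green
  identity in ambient terms, parts 2–3) is added, and Hamilton's pointwise identity (backward heat
  equation + completing the square, part 4) turns the integrand into `-k(H + Dk(ν)/k)² - Q`;
* `IsCylinderMCF.continuousWithinAt_cylDensity` — `Z` is continuous from the right at `T`
  (part 5, dominated convergence);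
* `stub_hamiltonMonotonicity_part7` — the registered sub-goal marker (right-continuity).

Everything is PROVED (no `sorry`, no new definitions, no named facts).

References: R. S. Hamilton, Comm. Anal. Geom. 1 (1993) 127–137, Thm. 4.1 and §4; G. Huisken,
J. Differential Geom. 31 (1990), Thm. 3.1 (the Euclidean model of the computation).
-/

-- the prescribed namespace `Summit.SmoothPoincare4.SmoothPoincare4.…` repeats `SmoothPoincare4`
set_option linter.dupNamespace false

noncomputable section

open Bundle MeasureTheory Set Function Filter Module
open scoped Manifold ContDiff ENNReal Topology RealInnerProductSpace NNReal Matrix BigOperators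

namespace Summit.SmoothPoincare4.SmoothPoincare4.Cruxes.CylinderRungTwo.KillingFlux

open Literature.Geometry.Riemannian Literature.Geometry.Riemannian.EuclideanHypersurface
open Literature.Geometry.Lorentzian Literature.Geometry.Lorentzian.PseudoRiemannianMetric
open Literature.Analysis.Calculus
open Literature.Geometry.Riemannian.SphericalCylinderEntropy (cylKernel cylDensity cylEntropy truncL)

section Identity

open Literature.Geometry.Riemannian.SphericalCylinderEntropy (cylKernel cylDensity truncL
  contDiff_cylKernel cylKernel_pos contDiffAt_cylKernel_prod cylKernel_backward_heat)
open Literature.Geometry.Manifold.CylinderSlice (padL)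

variable {M : Type} [TopologicalSpace M] [ChartedSpace (EuclideanSpace ℝ (Fin 4)) M]
  [IsManifold (𝓡 4) ∞ M] [T2Space M] [CompactSpace M] {F ν : ℝ → M → EuclideanSpace ℝ (Fin 6)} {T : ℝ}

/-- **Hamilton's monotonicity formula for the typed density along a smooth cylinder flow,
derivative at an interior time.** For `IsCylinderMCF M F ν T`, `p ∈ N`, `T < t < t₀`, the typed
density `Z(s) = F̂_{p, t₀ - s}(F_s(M))` (as a real number) satisfies
`Z'(t) = -D - (μH⁴ S⁴)⁻¹ ∫_{F_t(M)} Q_{p,t₀-t}(z; ν) dμH⁴(z)` with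
`D = (μH⁴ S⁴)⁻¹ ∫_{F_t(M)} k (H + Dk(ν)/k)² dμH⁴ ≥ 0` and `Q` Hamilton's Harnack quadratic form of
the typed kernel along `N` evaluated on the unit normal (read on the embedded slice through
`Function.extend`). Proof: the density is `c ∫_M k_{p,t₀-s}(F_s w) dμ_s` (area formula), whose
derivative is `c ∫_M (-∂_τk - H Dk(ν) - H²k) dμ_t` (transport formula, part 1); adding
`0 = c ∫_M Δ_Σ(k|_Σ) dμ_t` (part 3) and completing the square pointwise
(`hamilton_kernel_identity`, backward heat equation of the kernel) gives the formula.
[cite: Hamilton1993, Thm. 4.1] -/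
theorem IsCylinderMCF.hasDerivAt_cylDensity (hF : IsCylinderMCF M F ν T)
    {p : EuclideanSpace ℝ (Fin 6)} (hp : ∑ i : Fin 5, p (Fin.castSucc i) ^ 2 = 1)
    {t₀ t₁ : ℝ} (hTt₁ : T < t₁) (ht₁t₀ : t₁ < t₀) :
    ∃ D : ℝ, 0 ≤ D ∧
      HasDerivAt (fun t => (cylDensity (Set.range (F t)) p (t₀ - t)).toReal)
        (-D - ((μH[4] (Metric.sphere (0 : EuclideanSpace ℝ (Fin 5)) 1))⁻¹).toReal *
          ∫ z in Set.range (F t₁),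
            (iteratedFDeriv ℝ 2 (cylKernel p (t₀ - t₁)) z
                ![Function.extend (F t₁) (ν t₁) 0 z, Function.extend (F t₁) (ν t₁) 0 z]
              - (∑ i : Fin 5, Function.extend (F t₁) (ν t₁) 0 z (Fin.castSucc i) ^ 2) *
                  fderiv ℝ (cylKernel p (t₀ - t₁)) z (padL (truncL z))
              - (fderiv ℝ (cylKernel p (t₀ - t₁)) z (Function.extend (F t₁) (ν t₁) 0 z)) ^ 2 /
                  cylKernel p (t₀ - t₁) z
              + cylKernel p (t₀ - t₁) z * ‖Function.extend (F t₁) (ν t₁) 0 z‖ ^ 2 / (2 * (t₀ - t₁)))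
            ∂μH[4]) t₁ := by
  letI : MeasurableSpace M := borel M
  haveI : BorelSpace M := ⟨rfl⟩
  obtain ⟨c, hc0, hHE⟩ := exists_euclideanHausdorff_six_eq_smul
  -- times and constants
  set a : ℝ := (T + t₁) / 2 with ha
  have hTa : T < a := by rw [ha]; linarith
  have ht₁ab : t₁ ∈ Ioo a t₀ := ⟨by rw [ha]; linarith, ht₁t₀⟩
  have hTt₁' : T ≤ t₁ := hTt₁.le
  have hτ : 0 < t₀ - t₁ := sub_pos.2 ht₁t₀
  set C₀ : ℝ := ((μH[4] (Metric.sphere (0 : EuclideanSpace ℝ (Fin 5)) 1))⁻¹).toReal with hC₀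
  set Cst : ℝ := C₀ * (c : ℝ)⁻¹ with hCst
  have hC₀nn : 0 ≤ C₀ := ENNReal.toReal_nonneg
  have hCstnn : 0 ≤ Cst := mul_nonneg hC₀nn (inv_nonneg.2 c.coe_nonneg)
  -- the metric and measure at `t₁`, the slice data
  set g₁ := (euclideanMetric (EuclideanSpace ℝ (Fin 6))).inducedRiemannianMetric (F t₁)
    contMDiff_pullbackBilin_holds (hF.isSpacelikeImmersion t₁ hTt₁') with hg₁
  set μ₁ := riemannianMeasure g₁ with hμ₁
  haveI : IsFiniteMeasure μ₁ := isFiniteMeasure_riemannianMeasure _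
  set Hm : M → ℝ := fun w => (euclideanMetric (EuclideanSpace ℝ (Fin 6))).meanCurvature (F t₁)
    contMDiff_pullbackBilin_holds (hF.isSpacelikeImmersion t₁ hTt₁') (ν t₁) w with hHm
  set k : EuclideanSpace ℝ (Fin 6) → ℝ := cylKernel p (t₀ - t₁) with hk
  have hks : ContDiff ℝ ∞ k := contDiff_cylKernel p hτ
  have hFc : Continuous (F t₁) := (hF.isSpacelikeImmersion t₁ hTt₁').contMDiff.continuous
  have hνc : Continuous (ν t₁) := (hF.contMDiff_normal t₁ hTt₁').continuous
  have hkpos : ∀ w, 0 < k (F t₁ w) := fun w => cylKernel_pos hp (hF.mem_cyl t₁ hTt₁' w) hτ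
  -- (1) the transport formula for `f(t, w) = k_{p, t₀ - t}(F_t w)`
  obtain ⟨hf'c, hfd⟩ := hF.hasDerivAt_cylKernel_comp p hTa (le_refl t₀) (t₀ := t₀)
  have hfc := hF.continuousOn_cylKernel_comp p t₀ (S := Ioo a t₀)
    (fun t ht => mem_Ici.2 (hTa.le.trans ht.1.le)) (fun t ht => ht.2)
  have hmain := hF.hasDerivAt_integral_mul_density hTa.le ht₁ab hfc hf'c hfd
  -- (2) the density near `t₁` is `Cst · ∫ f θ dμ₁`
  have hZ : (fun t => (cylDensity (Set.range (F t)) p (t₀ - t)).toReal) =ᶠ[𝓝 t₁] fun t =>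
      Cst * ∫ w, cylKernel p (t₀ - t) (F t w) *
        (Real.sqrt (Matrix.of fun i j =>
          (euclideanMetric (EuclideanSpace ℝ (Fin 6))).inducedBilin (𝓡 4) (F t) w
            ((trivializationAt (EuclideanSpace ℝ (Fin 4)) (TangentSpace (𝓡 4)) w).localFrame
              (EuclideanSpace.basisFun (Fin 4) ℝ).toBasis i w)
            ((trivializationAt (EuclideanSpace ℝ (Fin 4)) (TangentSpace (𝓡 4)) w).localFrame
              (EuclideanSpace.basisFun (Fin 4) ℝ).toBasis j w)).det /
         Real.sqrt (Matrix.of fun i j =>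
          (euclideanMetric (EuclideanSpace ℝ (Fin 6))).inducedBilin (𝓡 4) (F t₁) w
            ((trivializationAt (EuclideanSpace ℝ (Fin 4)) (TangentSpace (𝓡 4)) w).localFrame
              (EuclideanSpace.basisFun (Fin 4) ℝ).toBasis i w)
            ((trivializationAt (EuclideanSpace ℝ (Fin 4)) (TangentSpace (𝓡 4)) w).localFrame
              (EuclideanSpace.basisFun (Fin 4) ℝ).toBasis j w)).det) ∂μ₁ := by
    filter_upwards [isOpen_Ioo.mem_nhds ht₁ab] with t ht
    have hTt : T ≤ t := hTa.le.trans ht.1.le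
    rw [hF.toReal_cylDensity_eq hTt hc0 hHE hp (sub_pos.2 ht.2),
      hF.integral_riemannianMeasure_eq hTt hTt₁']
    simp only [hCst, hC₀, smul_eq_mul, mul_comm (cylKernel p (t₀ - t) _)]
    rfl
  have hderZ := (hmain.const_mul Cst).congr_of_eventuallyEq hZ
  -- (3) the value of the derivative
  -- continuity of the slice quantities
  have hDc : Continuous fun w => deriv (fun s => F s w) t₁ := by
    obtain ⟨U, hU, hIU, hFj⟩ := hF.contMDiffOn
    exact (continuousOn_timeDeriv hU hFj).comp_continuous (continuous_const.prodMk continuous_id)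
      fun w => ⟨hIU (mem_Ici.2 hTt₁'), mem_univ _⟩
  have hHc : Continuous Hm := by
    have hfun : Hm = fun w => -⟪deriv (fun s => F s w) t₁, ν t₁ w⟫ :=
      funext fun w => hF.meanCurvature_eq_neg_inner_deriv hTt₁' w
    rw [hfun]
    exact (hDc.inner hνc).neg
  have hkc : Continuous fun w => k (F t₁ w) := hks.continuous.comp hFc
  have hDkc : ∀ {v : M → EuclideanSpace ℝ (Fin 6)}, Continuous v →
      Continuous fun w => fderiv ℝ k (F t₁ w) (v w) := fun hv =>
    ((hks.continuous_fderiv (by simp)).comp hFc).clm_apply hv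
  have hD2kc : ∀ {v : M → EuclideanSpace ℝ (Fin 6)}, Continuous v →
      Continuous fun w => iteratedFDeriv ℝ 2 k (F t₁ w) ![v w, v w] := fun {v} hv => by
    have h1 : Continuous fun w => fderiv ℝ (fderiv ℝ k) (F t₁ w) (v w) (v w) :=
      ((((hks.fderiv_right (m := ∞) (by simp)).continuous_fderiv (by simp)).comp hFc).clm_apply hv).clm_apply hv
    refine h1.congr fun w => ?_
    rw [iteratedFDeriv_two_apply]
    rfl
  have hnc : Continuous fun w => padL (truncL (F t₁ w)) := (padL.comp truncL).continuous.comp hFc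
  have hsqc : Continuous fun w => ∑ i : Fin 5, ν t₁ w (Fin.castSucc i) ^ 2 :=
    continuous_finsetSum _ fun i _ => ((EuclideanSpace.proj (Fin.castSucc i)).continuous.comp hνc).pow 2
  have hdτc : Continuous fun w => deriv (fun τ' : ℝ => cylKernel p τ' (F t₁ w)) (t₀ - t₁) := by
    have h1 : Continuous fun w => fderiv ℝ (fun q : ℝ × EuclideanSpace ℝ (Fin 6) => cylKernel p q.1 q.2)
        (t₀ - t₁, F t₁ w) ((1 : ℝ), (0 : EuclideanSpace ℝ (Fin 6))) := by
      have hopen : IsOpen (Ioi (0 : ℝ) ×ˢ (univ : Set (EuclideanSpace ℝ (Fin 6)))) :=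
        isOpen_Ioi.prod isOpen_univ
      have hKs : ContDiffOn ℝ ∞ (fun q : ℝ × EuclideanSpace ℝ (Fin 6) => cylKernel p q.1 q.2)
          (Ioi 0 ×ˢ univ) := fun q hq => (contDiffAt_cylKernel_prod p hq.1).contDiffWithinAt
      have hDK := hKs.continuousOn_fderiv_of_isOpen hopen (by simp)
      have h2 : Continuous fun w => ((t₀ - t₁, F t₁ w) : ℝ × EuclideanSpace ℝ (Fin 6)) :=
        continuous_const.prodMk hFc
      exact ((hDK.comp_continuous h2 fun w => ⟨hτ, mem_univ _⟩)).clm_apply continuous_const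
    refine h1.congr fun w => ?_
    rw [fderiv_cylKernel_prod_apply p hτ, one_mul, map_zero, add_zero]
  -- the three integrands
  set A : M → ℝ := fun w => k (F t₁ w) * (Hm w + fderiv ℝ k (F t₁ w) (ν t₁ w) / k (F t₁ w)) ^ 2 with hA
  set Q : M → ℝ := fun w => iteratedFDeriv ℝ 2 k (F t₁ w) ![ν t₁ w, ν t₁ w]
      - (∑ i : Fin 5, ν t₁ w (Fin.castSucc i) ^ 2) * fderiv ℝ k (F t₁ w) (padL (truncL (F t₁ w)))
      - (fderiv ℝ k (F t₁ w) (ν t₁ w)) ^ 2 / k (F t₁ w)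
      + k (F t₁ w) * ‖ν t₁ w‖ ^ 2 / (2 * (t₀ - t₁)) with hQ
  set B : M → ℝ := fun w => (((∑ j : Fin 6, iteratedFDeriv ℝ 2 k (F t₁ w)
          ![EuclideanSpace.single j (1 : ℝ), EuclideanSpace.single j (1 : ℝ)])
        - iteratedFDeriv ℝ 2 k (F t₁ w) ![padL (truncL (F t₁ w)), padL (truncL (F t₁ w))]
        - 4 * fderiv ℝ k (F t₁ w) (padL (truncL (F t₁ w))))
      - (iteratedFDeriv ℝ 2 k (F t₁ w) ![ν t₁ w, ν t₁ w]
        - (∑ i : Fin 5, ν t₁ w (Fin.castSucc i) ^ 2) * fderiv ℝ k (F t₁ w) (padL (truncL (F t₁ w))))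
      - Hm w * fderiv ℝ k (F t₁ w) (ν t₁ w)) with hB
  set L : M → ℝ := fun w => fderiv ℝ (fun q : ℝ × EuclideanSpace ℝ (Fin 6) => cylKernel p q.1 q.2)
      (t₀ - t₁, F t₁ w) (-1, deriv (fun s => F s w) t₁) - Hm w ^ 2 * cylKernel p (t₀ - t₁) (F t₁ w) with hL
  have hAc : Continuous A := hkc.mul ((hHc.add ((hDkc hνc).div hkc fun w => (hkpos w).ne')).pow 2)
  have hQc : Continuous Q :=
    (((hD2kc hνc).sub (hsqc.mul (hDkc hnc))).sub (((hDkc hνc).pow 2).div hkc fun w => (hkpos w).ne')).add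
      ((hkc.mul ((hνc.norm).pow 2)).div_const _)
  have hBc : Continuous B := by
    refine ((((continuous_finsetSum _ fun j _ => ?_).sub (hD2kc hnc)).sub
      (continuous_const.mul (hDkc hnc))).sub ((hD2kc hνc).sub (hsqc.mul (hDkc hnc)))).sub (hHc.mul (hDkc hνc))
    exact hD2kc continuous_const
  have hLB : ∀ w, L w + B w = -A w - Q w := fun w => by
    have h1 := hF.transportIntegrand_cylKernel_eq p hTt₁' ht₁t₀ w (t₀ := t₀)
    have h2 := hamilton_kernel_identity p hp hτ (F t₁ w) (hkpos w).ne' (ν t₁ w) (hF.norm_normal hTt₁' w) (Hm w)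
    simp only [hL, hB, hA, hQ, hk, hHm] at h1 h2 ⊢
    rw [h1]
    linarith [h2]
  have hB0 : ∫ w, B w ∂μ₁ = 0 :=
    integral_sliceLaplacian_eq_zero (hF.isSpacelikeImmersion t₁ hTt₁') (hF.contMDiff_normal t₁ hTt₁')
      (hF.isUnitNormal t₁ hTt₁') (hF.mem_cyl t₁ hTt₁') (hF.normal_tangent t₁ hTt₁') (hks.of_le (by norm_cast))
  have hAi : Integrable A μ₁ := integrable_of_continuous (h := g₁) hAc
  have hQi : Integrable Q μ₁ := integrable_of_continuous (h := g₁) hQc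
  have hBi : Integrable B μ₁ := integrable_of_continuous (h := g₁) hBc
  have hLi : Integrable L μ₁ := by
    have : L = fun w => (-A w - Q w) - B w := funext fun w => by linarith [hLB w]
    rw [this]
    exact (hAi.neg.sub hQi).sub hBi
  have hval : ∫ w, L w ∂μ₁ = -∫ w, A w ∂μ₁ - ∫ w, Q w ∂μ₁ := by
    have h1 : ∫ w, L w ∂μ₁ = ∫ w, (L w + B w) ∂μ₁ - ∫ w, B w ∂μ₁ := by
      rw [integral_add hLi hBi]; ring
    have hAi' : Integrable (fun w => -A w) μ₁ := hAi.neg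
    rw [h1, hB0, sub_zero, integral_congr_ae (Eventually.of_forall hLB), integral_sub hAi' hQi,
      integral_neg]
  -- (4) the Harnack integral on the embedded slice
  have hinj : Injective (F t₁) := hF.injective hTt₁'
  have hQ' : ∫ w, Q w ∂μ₁ = (c : ℝ) * ∫ z in Set.range (F t₁),
      (iteratedFDeriv ℝ 2 (cylKernel p (t₀ - t₁)) z
          ![Function.extend (F t₁) (ν t₁) 0 z, Function.extend (F t₁) (ν t₁) 0 z]
        - (∑ i : Fin 5, Function.extend (F t₁) (ν t₁) 0 z (Fin.castSucc i) ^ 2) *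
            fderiv ℝ (cylKernel p (t₀ - t₁)) z (padL (truncL z))
        - (fderiv ℝ (cylKernel p (t₀ - t₁)) z (Function.extend (F t₁) (ν t₁) 0 z)) ^ 2 /
            cylKernel p (t₀ - t₁) z
        + cylKernel p (t₀ - t₁) z * ‖Function.extend (F t₁) (ν t₁) 0 z‖ ^ 2 / (2 * (t₀ - t₁))) ∂μH[4] := by
    rw [← smul_eq_mul, hF.smul_setIntegral_range_eq hTt₁' hHE]
    refine integral_congr_ae (Eventually.of_forall fun w => ?_)
    simp only [hQ, hk, hinj.extend_apply]
  -- (5) assembly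
  refine ⟨Cst * ∫ w, A w ∂μ₁, mul_nonneg hCstnn (integral_nonneg fun w =>
    mul_nonneg (hkpos w).le (sq_nonneg _)), ?_⟩
  refine hderZ.congr_deriv ?_
  have hc0' : (c : ℝ) ≠ 0 := NNReal.coe_ne_zero.2 hc0
  have key : ∀ X Y : ℝ, Cst * (-X - (c : ℝ) * Y) = -(Cst * X) - C₀ * Y := fun X Y => by
    rw [hCst]
    field_simp
  show Cst * ∫ w, L w ∂μ₁ = _
  rw [hval, hQ']
  exact key _ _

end Identity

section Continuity

open Literature.Geometry.Riemannian.SphericalCylinderEntropy (cylKernel cylDensity truncL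
  contDiff_cylKernel cylKernel_pos contDiffAt_cylKernel_prod)

variable {M : Type} [TopologicalSpace M] [ChartedSpace (EuclideanSpace ℝ (Fin 4)) M]
  [IsManifold (𝓡 4) ∞ M] [T2Space M] [CompactSpace M] {F ν : ℝ → M → EuclideanSpace ℝ (Fin 6)} {T : ℝ}

/-- **The typed density of the moving slice is continuous from the right at the initial time**:
for `IsCylinderMCF M F ν T`, `p ∈ N` and `t₀ > T`, `t ↦ F̂_{p, t₀ - t}(F_t(M))` (as a real number)
is continuous within `[T, ∞)` at `T` (the density is `c ∫_M k_{p,t₀-t}(F_t w) θ_t(w) dμ_T(w)`,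
area formula, and dominated convergence on the compact `M`,
`IsCylinderMCF.continuousWithinAt_integral_mul_density`). [cite: Hamilton1993, Thm. 4.1] -/
theorem IsCylinderMCF.continuousWithinAt_cylDensity (hF : IsCylinderMCF M F ν T)
    {p : EuclideanSpace ℝ (Fin 6)} (hp : ∑ i : Fin 5, p (Fin.castSucc i) ^ 2 = 1)
    {t₀ : ℝ} (hTt₀ : T < t₀) :
    ContinuousWithinAt (fun t => (cylDensity (Set.range (F t)) p (t₀ - t)).toReal) (Set.Ici T) T := by
  letI : MeasurableSpace M := borel M
  haveI : BorelSpace M := ⟨rfl⟩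
  obtain ⟨c, hc0, hHE⟩ := exists_euclideanHausdorff_six_eq_smul
  set Cst : ℝ := ((μH[4] (Metric.sphere (0 : EuclideanSpace ℝ (Fin 5)) 1))⁻¹).toReal * (c : ℝ)⁻¹
    with hCst
  have hfc := hF.continuousOn_cylKernel_comp p t₀ (S := Ico T t₀) (fun t ht => mem_Ici.2 ht.1)
    (fun t ht => ht.2)
  have hcont := hF.continuousWithinAt_integral_mul_density hTt₀ hfc
  have hnhds : Ico T t₀ ∈ 𝓝[Ici T] T := by
    rw [mem_nhdsWithin]
    exact ⟨Iio t₀, isOpen_Iio, by simpa using hTt₀, fun t ht => ⟨ht.2, ht.1⟩⟩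
  have hZ : ∀ t ∈ Ico T t₀, (cylDensity (Set.range (F t)) p (t₀ - t)).toReal =
      Cst * ∫ w, cylKernel p (t₀ - t) (F t w) *
        (Real.sqrt (Matrix.of fun i j =>
          (euclideanMetric (EuclideanSpace ℝ (Fin 6))).inducedBilin (𝓡 4) (F t) w
            ((trivializationAt (EuclideanSpace ℝ (Fin 4)) (TangentSpace (𝓡 4)) w).localFrame
              (EuclideanSpace.basisFun (Fin 4) ℝ).toBasis i w)
            ((trivializationAt (EuclideanSpace ℝ (Fin 4)) (TangentSpace (𝓡 4)) w).localFrame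
              (EuclideanSpace.basisFun (Fin 4) ℝ).toBasis j w)).det /
         Real.sqrt (Matrix.of fun i j =>
          (euclideanMetric (EuclideanSpace ℝ (Fin 6))).inducedBilin (𝓡 4) (F T) w
            ((trivializationAt (EuclideanSpace ℝ (Fin 4)) (TangentSpace (𝓡 4)) w).localFrame
              (EuclideanSpace.basisFun (Fin 4) ℝ).toBasis i w)
            ((trivializationAt (EuclideanSpace ℝ (Fin 4)) (TangentSpace (𝓡 4)) w).localFrame
              (EuclideanSpace.basisFun (Fin 4) ℝ).toBasis j w)).det)
        ∂riemannianMeasure ((euclideanMetric (EuclideanSpace ℝ (Fin 6))).inducedRiemannianMetric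
          (F T) contMDiff_pullbackBilin_holds (hF.isSpacelikeImmersion T le_rfl)) := by
    intro t ht
    rw [hF.toReal_cylDensity_eq ht.1 hc0 hHE hp (sub_pos.2 ht.2),
      hF.integral_riemannianMeasure_eq ht.1 le_rfl]
    simp only [hCst, smul_eq_mul, mul_comm (cylKernel p (t₀ - t) _)]
  refine ((continuousWithinAt_const (b := Cst)).mul hcont).congr_of_eventuallyEq ?_
    (hZ T ⟨le_rfl, hTt₀⟩)
  filter_upwards [hnhds] with t ht
  exact hZ t ht

end Continuity

/-- **Registered sub-goal marker `stub_hamiltonMonotonicity_part7` (right-continuity of the typed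
density of the moving slice at the initial time).** For `IsCylinderMCF M F ν T`, `p ∈ N` and
`t₀ > T`, `t ↦ F̂_{p,t₀-t}(F_t(M))` (as a real number) is continuous within `[T, ∞)` at `T`
(`IsCylinderMCF.continuousWithinAt_cylDensity`). [cite: Hamilton1993, Thm. 4.1] -/
theorem stub_hamiltonMonotonicity_part7 :
    ∀ (M : Type) [TopologicalSpace M] [ChartedSpace (EuclideanSpace ℝ (Fin 4)) M] [IsManifold (𝓡 4) ∞ M] [T2Space M] [CompactSpace M] (F : ℝ → M → EuclideanSpace ℝ (Fin 6)) (ν : ℝ → M → EuclideanSpace ℝ (Fin 6)) (T : ℝ), IsCylinderMCF M F ν T → ∀ (p : EuclideanSpace ℝ (Fin 6)), ∑ i : Fin 5, p (Fin.castSucc i) ^ 2 = 1 → ∀ (t₀ : ℝ), T < t₀ → ContinuousWithinAt (fun t => (Literature.Geometry.Riemannian.SphericalCylinderEntropy.cylDensity (Set.range (F t)) p (t₀ - t)).toReal) (Set.Ici T) T :=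
  fun _ _ _ _ _ _ _ _ _ hF _ hp _ hTt₀ => hF.continuousWithinAt_cylDensity hp hTt₀

end Summit.SmoothPoincare4.SmoothPoincare4.Cruxes.CylinderRungTwo.KillingFlux

end
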